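import Mathlib
import Literature.Probability.Percolation.PercolationProofs
import Literature.Probability.Percolation.BondPercolationBlockIndependence
import Literature.Probability.Percolation.HalfSpacePinnedPairs
import Literature.Probability.LatticeModels.StarLattice
import HarnessLib

/-!
# Crux `PercBurnResprinkle.JumpFireBreak` (stmt-CriticalPhenomena-7204), line `vacant-coins-fresh-spine` — stub `stub_crossIndep`

Helper file for the crux skeleton `Cruxes/JumpFireBreak/Lines/vacant-coins-fresh-spine.lean` (lead
prover-line-stmt-CriticalPhenomena-7204-0).  Proves exactly the registered stub signature; lands with
`--supports stmt-CriticalPhenomena-7204`.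

Locality and independence of the local bad events: the sparse product bound for blocks pairwise at
block sup-distance > 8.

Route.  (1) *Locality*: the local bad event of the glue at scale `(L, r)`, level `q`, centre `c'`
depends only on the labels of the pairs inside the cube `c' + box 3 (3L + r + 1)` (an open path of
the `p_c`-cluster of `v` leaving `v + box r` exits through `v + box (r + 1)`, so smallness of the
cluster is decided inside `v + box (r + 1)`).  (2) *Disjointness*: for block indices at sup-distance
`≥ 9` the cubes of radius `3L + r + 1 ≤ 4L + 1` around the centres `c + L • b` are disjoint
(`L ≥ 3`).  (3) *Independence*: under the i.i.d. label measure the coordinate σ-algebras are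
mutually independent (`iIndepFun_infinitePi`), hence so are the σ-algebras of pairwise disjoint
sets of pairs (`iIndep_biSup_of_pairwise_disjoint`); the bad events are measurable for them (mask
trick), and `iIndep.meas_biInter` gives the product formula, whence the bound `δ ^ (9^3 · #T)`.
No auxiliary definitions: the pairs inside `c' + box 3 R` are written `{e | ∀ z ∈ e, z - c' ∈ box 3 R}`
and the σ-algebra of a set of pairs `F` is `⨆ e ∈ F, MeasurableSpace.comap (fun U => U e) _`.
-/

noncomputable section

namespace Summit.CriticalPhenomena.PercolationContinuityZ3.Theorems

open MeasureTheory ProbabilityTheory Literature.Probability.Percolation Literature.Probability.LatticeModels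

namespace CrossIndep

/-! ### Generic tools on the label space `Sym2 V → ℝ` -/

section Generic

variable {V : Type*}

/-- Label fields agreeing on a pair give it the same state at every level. -/
theorem mem_configOfLabels_congr (G : SimpleGraph V) {F : Set (Sym2 V)} {U U' : Sym2 V → ℝ}
    (h : Set.EqOn U U' F) (p : ℝ) {e : Sym2 V} (he : e ∈ F) :
    e ∈ configOfLabels p U G ↔ e ∈ configOfLabels p U' G := by
  simp only [configOfLabels, Set.mem_setOf_eq, h he]

/-- **Locality of `{a ↔ b in S}`**: label fields agreeing on the pairs of `S` induce the same open
graph on `S`, hence the same event `{a ↔ b in S}` for the thresholded configuration. -/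
theorem configOfLabels_mem_openConnIn_congr (G : SimpleGraph V) {S : Set V} {F : Set (Sym2 V)}
    {U U' : Sym2 V → ℝ} (hS : ∀ x ∈ S, ∀ y ∈ S, s(x, y) ∈ F) (h : Set.EqOn U U' F) (q : ℝ) (a b : V) :
    configOfLabels q U G ∈ openConnIn S a b ↔ configOfLabels q U' G ∈ openConnIn S a b := by
  have hG : (openGraph (configOfLabels q U G)).induce S = (openGraph (configOfLabels q U' G)).induce S := by
    ext x y
    simp only [SimpleGraph.comap_adj, Function.Embedding.coe_subtype, openGraph_adj]
    rw [mem_configOfLabels_congr G h q (hS x x.2 y y.2)]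
  simp only [openConnIn, Set.mem_setOf_eq, hG]

/-- **The mask trick**: a product-measurable event `A` that is stable under agreement on the pairs
of `F` is measurable for the σ-algebra generated by the labels of `F` (it is its own preimage under
the mask `U ↦ (e ↦ if e ∈ F then U e else 0)`, which is measurable from that σ-algebra). -/
theorem measurableSet_iSup_of_local {A : Set (Sym2 V → ℝ)} {F : Set (Sym2 V)} (hA : MeasurableSet A)
    (hloc : ∀ U U', Set.EqOn U U' F → U ∈ A → U' ∈ A) :
    MeasurableSet[⨆ e ∈ F, MeasurableSpace.comap (fun U : Sym2 V → ℝ => U e) inferInstance] A := by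
  classical
  have hmask : Measurable[⨆ e ∈ F, MeasurableSpace.comap (fun U : Sym2 V → ℝ => U e) inferInstance]
      fun (U : Sym2 V → ℝ) (e : Sym2 V) => if e ∈ F then U e else (0 : ℝ) := by
    refine (@measurable_pi_iff (Sym2 V → ℝ) (Sym2 V) (fun _ => ℝ)
      (⨆ e ∈ F, MeasurableSpace.comap (fun U : Sym2 V → ℝ => U e) inferInstance) _ _).2 fun e => ?_
    by_cases he : e ∈ F
    · have h : (fun U : Sym2 V → ℝ => if e ∈ F then U e else (0 : ℝ)) = fun U => U e :=
        funext fun U => by simp [he]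
      refine h ▸ Measurable.of_comap_le (le_iSup₂ (f := fun (e : Sym2 V) (_ : e ∈ F) =>
        MeasurableSpace.comap (fun U : Sym2 V → ℝ => U e) inferInstance) e he)
    · have h : (fun U : Sym2 V → ℝ => if e ∈ F then U e else (0 : ℝ)) = fun _ => 0 :=
        funext fun U => by simp [he]
      exact h ▸ measurable_const
  have heq : ∀ U : Sym2 V → ℝ, Set.EqOn U (fun e => if e ∈ F then U e else 0) F :=
    fun U e he => by simp [he]
  have h : (fun (U : Sym2 V → ℝ) (e : Sym2 V) => if e ∈ F then U e else (0 : ℝ)) ⁻¹' A = A :=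
    Set.ext fun U => ⟨fun hU => hloc _ _ (heq U).symm hU, fun hU => hloc _ _ (heq U) hU⟩
  rw [← h]
  exact hmask hA

/-- Under the i.i.d. label measure the coordinate σ-algebras are mutually independent. -/
theorem iIndep_coord : iIndep (fun e : Sym2 V => MeasurableSpace.comap (fun U : Sym2 V → ℝ => U e) inferInstance)
    (labelMeasure V) := by
  have := isProbabilityMeasure_volume_restrict_unitInterval
  have h := iIndepFun_infinitePi (P := fun _ : Sym2 V => (volume : Measure ℝ).restrict (Set.Icc (0 : ℝ) 1))
    (X := fun _ x => x) (fun _ => measurable_id)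
  rw [iIndepFun_iff_iIndep] at h
  exact h

/-- **Sparse product bound, abstract form**: events `A b`, `b ∈ T`, each measurable for the labels of
a set of pairs `F b`, with the `F b` pairwise disjoint over `T`, are mutually independent under the
label measure; so if each has probability `≤ x`, their intersection has probability `≤ x ^ #T`. -/
theorem measureReal_biInter_le_pow {ι : Type*} (T : Finset ι) (F : ι → Set (Sym2 V))
    (hF : ∀ b ∈ T, ∀ b' ∈ T, b ≠ b' → Disjoint (F b) (F b')) (A : ι → Set (Sym2 V → ℝ))
    (hA : ∀ b ∈ T,
      MeasurableSet[⨆ e ∈ F b, MeasurableSpace.comap (fun U : Sym2 V → ℝ => U e) inferInstance] (A b))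
    {x : ℝ} (hle : ∀ b ∈ T, (labelMeasure V).real (A b) ≤ x) :
    (labelMeasure V).real (⋂ b ∈ T, A b) ≤ x ^ T.card := by
  classical
  let S : ι → Set (Sym2 V) := fun b => if b ∈ T then F b else ∅
  have hSmem : ∀ b ∈ T, S b = F b := fun b hb => if_pos hb
  have hS : Pairwise fun b b' => Disjoint (S b) (S b') := by
    intro b b' hne
    by_cases hb : b ∈ T
    · by_cases hb' : b' ∈ T
      · rw [hSmem b hb, hSmem b' hb']
        exact hF b hb b' hb' hne
      · rw [show S b' = ∅ from if_neg hb']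
        exact Set.disjoint_empty _
    · rw [show S b = ∅ from if_neg hb]
      exact Set.empty_disjoint _
  have hind : iIndep (fun b => ⨆ e ∈ S b, MeasurableSpace.comap (fun U : Sym2 V → ℝ => U e) inferInstance)
      (labelMeasure V) :=
    iIndep_biSup_of_pairwise_disjoint (fun e => (measurable_pi_apply e).comap_le) iIndep_coord S hS
  have hmeas : ∀ b ∈ T,
      MeasurableSet[⨆ e ∈ S b, MeasurableSpace.comap (fun U : Sym2 V → ℝ => U e) inferInstance] (A b) := by
    intro b hb
    rw [hSmem b hb]
    exact hA b hb
  have hprod : labelMeasure V (⋂ b ∈ T, A b) = ∏ b ∈ T, labelMeasure V (A b) := hind.meas_biInter hmeas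
  rw [measureReal_def, hprod, ENNReal.toReal_prod, ← Finset.prod_const]
  exact Finset.prod_le_prod (fun b _ => ENNReal.toReal_nonneg) fun b hb => hle b hb

/-- `{U | η_q(U) ∈ {a ↔ b in R(U)}}` is measurable for a *random* finite region `R(U)` with
measurable membership events: decompose along the countably many possible values of `R(U)`. -/
theorem measurableSet_connIn_of_region [Countable V] (G : SimpleGraph V) {R : (Sym2 V → ℝ) → Set V}
    (hfin : ∀ U, (R U).Finite) (hmeas : ∀ v, MeasurableSet {U | v ∈ R U}) (q : ℝ) (a b : V) :
    MeasurableSet {U : Sym2 V → ℝ | configOfLabels q U G ∈ openConnIn (R U) a b} := by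
  have h : {U : Sym2 V → ℝ | configOfLabels q U G ∈ openConnIn (R U) a b} =
      ⋃ S' : Finset V, {U | R U = ↑S'} ∩ (fun U => configOfLabels q U G) ⁻¹' openConnIn (↑S') a b := by
    ext U
    simp only [Set.mem_setOf_eq, Set.mem_iUnion, Set.mem_inter_iff, Set.mem_preimage]
    constructor
    · intro hU
      exact ⟨(hfin U).toFinset, by rw [Set.Finite.coe_toFinset], by rwa [Set.Finite.coe_toFinset]⟩
    · rintro ⟨S', hS', hU⟩
      rwa [hS']
  rw [h]
  refine MeasurableSet.iUnion fun S' => MeasurableSet.inter ?_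
    ((measurable_configOfLabels q G) (measurableSet_openConnIn_of_countable (↑S') a b))
  have h2 : {U | R U = ↑S'} = ⋂ v : V, {U | v ∈ R U ↔ v ∈ S'} := by
    ext U
    simp only [Set.mem_setOf_eq, Set.mem_iInter, Set.ext_iff, Finset.mem_coe]
  rw [h2]
  refine MeasurableSet.iInter fun v => ?_
  by_cases hv : v ∈ S'
  · simp only [hv, iff_true]
    exact hmeas v
  · simp only [hv, iff_false]
    exact (hmeas v).compl

end Generic

/-! ### Locality of the local bad event on `ℤ³` -/

/-- A lattice neighbour of a point of `v + box 3 r` lies in `v + box 3 (r + 1)`. -/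
theorem sub_mem_box_succ_of_adj {x y v : Site 3} {r : ℕ} (hadj : (zdGraph 3).Adj x y)
    (hx : x - v ∈ box 3 r) : y - v ∈ box 3 (r + 1) := by
  rw [mem_box] at hx ⊢
  obtain ⟨i, h | h⟩ := (zdGraph_adj_iff x y).1 hadj <;> intro j <;> have := hx j <;> subst h <;>
    simp only [Pi.sub_apply, Pi.add_apply, Pi.single_apply] at this ⊢ <;>
    split_ifs at this ⊢ <;> push_cast at this ⊢ <;> omega

/-- If the level-`p` cluster of `v` for `U` stays in `v + box 3 r` and `U'` agrees with `U` on the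
pairs inside `v + box 3 (r + 1)`, then the `U'`-cluster of `v` is contained in the `U`-cluster of
`v` (induction along an open path: each new edge starts in `v + box r`, so lies in `v + box (r + 1)`). -/
theorem openCluster_subset_of_eqOn {p : ℝ} {r : ℕ} {U U' : Sym2 (Site 3) → ℝ} {v : Site 3}
    (hsmall : openCluster (configOfLabels p U (zdGraph 3)) v ⊆ {y | y - v ∈ (box 3 r : Set (Site 3))})
    (h : Set.EqOn U U' {e | ∀ z ∈ e, z - v ∈ box 3 (r + 1)}) :
    openCluster (configOfLabels p U' (zdGraph 3)) v ⊆ openCluster (configOfLabels p U (zdGraph 3)) v := by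
  intro y hy
  change (openGraph _).Reachable v y at hy
  change (openGraph _).Reachable v y
  rw [SimpleGraph.reachable_iff_reflTransGen] at hy ⊢
  induction hy with
  | refl => exact Relation.ReflTransGen.refl
  | @tail x y _ hxy ih =>
    have hx : x ∈ openCluster (configOfLabels p U (zdGraph 3)) v :=
      (SimpleGraph.reachable_iff_reflTransGen _ _).2 ih
    have hxbox : x - v ∈ box 3 r := by simpa only [Set.mem_setOf_eq, Finset.mem_coe] using hsmall hx
    rw [openGraph_adj] at hxy
    obtain ⟨hmem, hne⟩ := hxy
    have he : ∀ z ∈ s(x, y), z - v ∈ box 3 (r + 1) := by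
      intro z hz
      rcases Sym2.mem_iff.1 hz with rfl | rfl
      exacts [box_mono 3 (Nat.le_succ r) hxbox, sub_mem_box_succ_of_adj hmem.1 hxbox]
    refine ih.tail ?_
    rw [openGraph_adj]
    exact ⟨(mem_configOfLabels_congr (zdGraph 3) h p he).2 hmem, hne⟩

/-- **Locality of smallness**: whether the level-`p` cluster of `v` stays in `v + box 3 r` depends
only on the labels of the pairs inside `v + box 3 (r + 1)`. -/
theorem small_congr {p : ℝ} {r : ℕ} {U U' : Sym2 (Site 3) → ℝ} {v : Site 3}
    (h : Set.EqOn U U' {e | ∀ z ∈ e, z - v ∈ box 3 (r + 1)}) :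
    openCluster (configOfLabels p U (zdGraph 3)) v ⊆ {y | y - v ∈ (box 3 r : Set (Site 3))} ↔
      openCluster (configOfLabels p U' (zdGraph 3)) v ⊆ {y | y - v ∈ (box 3 r : Set (Site 3))} :=
  ⟨fun hs => (openCluster_subset_of_eqOn hs h).trans hs,
    fun hs => (openCluster_subset_of_eqOn hs h.symm).trans hs⟩

/-- The pairs inside the small cubes around points of a cube lie inside the enlarged cube. -/
theorem setOf_pairs_subset {c' v : Site 3} {R r : ℕ} (hv : v - c' ∈ box 3 R) :
    {e : Sym2 (Site 3) | ∀ z ∈ e, z - v ∈ box 3 (r + 1)} ⊆ {e | ∀ z ∈ e, z - c' ∈ box 3 (R + r + 1)} := by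
  intro e he z hz
  have hzv := he z hz
  rw [mem_box] at hv hzv ⊢
  intro i
  have h1 := hv i
  have h2 := hzv i
  simp only [Pi.sub_apply] at h1 h2 ⊢
  push_cast at h1 h2 ⊢
  omega

/-- **Locality of the region** `{v ∈ c' + box 3 (3L) | C_p(v) ⊆ v + box 3 r}`: it depends only on
the labels of the pairs inside `c' + box 3 (3L + r + 1)`. -/
theorem region_congr {p : ℝ} {L r : ℕ} {U U' : Sym2 (Site 3) → ℝ} {c' : Site 3}
    (h : Set.EqOn U U' {e | ∀ z ∈ e, z - c' ∈ box 3 (3 * L + r + 1)}) :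
    {v | v - c' ∈ (box 3 (3 * L) : Set (Site 3)) ∧
        openCluster (configOfLabels p U (zdGraph 3)) v ⊆ {y | y - v ∈ (box 3 r : Set (Site 3))}} =
      {v | v - c' ∈ (box 3 (3 * L) : Set (Site 3)) ∧
        openCluster (configOfLabels p U' (zdGraph 3)) v ⊆ {y | y - v ∈ (box 3 r : Set (Site 3))}} := by
  ext v
  refine and_congr_right fun hv => small_congr (h.mono (setOf_pairs_subset ?_))
  simpa only [Finset.mem_coe] using hv

/-- The smallness event `{U | C_p(v; U) ⊆ v + box 3 r}` is measurable (a countable intersection of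
complements of connection events pulled back along the measurable thresholding map). -/
theorem measurableSet_small (p : ℝ) (r : ℕ) (v : Site 3) :
    MeasurableSet {U : Sym2 (Site 3) → ℝ |
      openCluster (configOfLabels p U (zdGraph 3)) v ⊆ {y | y - v ∈ (box 3 r : Set (Site 3))}} := by
  simp only [Set.subset_def, openCluster, Set.mem_setOf_eq]
  refine (Measurable.forall fun y => Measurable.imp ?_ measurable_const).setOf
  exact (measurableSet_openConn_holds v y).mem.comp (measurable_configOfLabels p (zdGraph 3))

/-- **The local bad event of the glue (scale `(L, r)`, smallness level `p`, path level `q`, centre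
`c'`) is measurable for the labels of the pairs inside `c' + box 3 (3L + r + 1)`.** -/
theorem measurableSet_iSup_crossEvt (p q : ℝ) (L r : ℕ) (c' : Site 3) :
    MeasurableSet[⨆ e ∈ {e : Sym2 (Site 3) | ∀ z ∈ e, z - c' ∈ box 3 (3 * L + r + 1)},
        MeasurableSpace.comap (fun U : Sym2 (Site 3) → ℝ => U e) inferInstance]
      {U | ∃ a b : Site 3, a - c' ∈ (box 3 L : Set (Site 3)) ∧ (∃ i, |b i - c' i| = 3 * L) ∧
        configOfLabels q U (zdGraph 3) ∈ openConnIn {v | v - c' ∈ (box 3 (3 * L) : Set (Site 3)) ∧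
          openCluster (configOfLabels p U (zdGraph 3)) v ⊆ {y | y - v ∈ (box 3 r : Set (Site 3))}} a b} := by
  refine measurableSet_iSup_of_local ?_ fun U U' h hU => ?_
  · -- measurability in the product σ-algebra
    refine (Measurable.exists fun a => Measurable.exists fun b => measurable_const.and
      (measurable_const.and (measurableSet_setOf.1 (measurableSet_connIn_of_region (zdGraph 3)
        (fun U => ?_) (fun v => ?_) q a b)))).setOf
    · exact ((box 3 (3 * L)).finite_toSet.preimage sub_left_injective.injOn).subset fun v hv => hv.1
    · exact (measurable_const.and (measurableSet_setOf.1 (measurableSet_small p r v))).setOf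
  · -- locality
    obtain ⟨a, b, ha, hb, hconn⟩ := hU
    refine ⟨a, b, ha, hb, ?_⟩
    rw [← region_congr (p := p) h]
    refine (configOfLabels_mem_openConnIn_congr (zdGraph 3) (fun x hx y hy => ?_) h q a b).1 hconn
    intro z hz
    have hx' : x - c' ∈ box 3 (3 * L) := by simpa only [Finset.mem_coe] using hx.1
    have hy' : y - c' ∈ box 3 (3 * L) := by simpa only [Finset.mem_coe] using hy.1
    rcases Sym2.mem_iff.1 hz with rfl | rfl
    · exact box_mono 3 (by omega) hx'
    · exact box_mono 3 (by omega) hy'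

/-! ### Disjointness of the supports of sparse blocks -/

/-- Two sparse block indices have a coordinate differing by at least `9`. -/
theorem exists_coord_of_lt_supDist {b b' : Site 3} (h : 8 < supDist b b') : ∃ i, 8 < (b i - b' i).natAbs := by
  by_contra hcon
  push Not at hcon
  exact absurd (supDist_le_iff.2 hcon) (not_le.2 h)

/-- **Disjointness**: the cubes of radius `3L + r + 1` around the centres `c + L • b`, `c + L • b'`
of two blocks at block sup-distance `> 8` share no pair (`L ≥ 3`, `r ≤ L`, so `9L > 2(3L + r + 1)`). -/
theorem disjoint_pairs_of_lt_supDist {L r : ℕ} (hL : 3 ≤ L) (hr : r ≤ L) {c b b' : Site 3}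
    (hbb' : 8 < supDist b b') :
    Disjoint {e : Sym2 (Site 3) | ∀ z ∈ e, z - (c + (L : ℤ) • b) ∈ box 3 (3 * L + r + 1)}
      {e | ∀ z ∈ e, z - (c + (L : ℤ) • b') ∈ box 3 (3 * L + r + 1)} := by
  rw [Set.disjoint_left]
  intro e he he'
  obtain ⟨i, hi⟩ := exists_coord_of_lt_supDist hbb'
  have h1 := he _ (Sym2.out_fst_mem e)
  have h2 := he' _ (Sym2.out_fst_mem e)
  rw [mem_box] at h1 h2
  obtain ⟨h1l, h1u⟩ := h1 i
  obtain ⟨h2l, h2u⟩ := h2 i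
  simp only [Pi.sub_apply, Pi.add_apply, Pi.smul_apply, smul_eq_mul] at h1l h1u h2l h2u
  push_cast at h1l h1u h2l h2u
  have hL' : (3 : ℤ) ≤ L := by exact_mod_cast hL
  have hr' : (r : ℤ) ≤ L := by exact_mod_cast hr
  have hk : (9 : ℤ) ≤ |b i - b' i| := by
    rw [Int.abs_eq_natAbs]
    exact_mod_cast hi
  rcases le_abs'.1 hk with hneg | hpos
  · have := mul_le_mul_of_nonneg_left hneg (show (0 : ℤ) ≤ L by positivity)
    nlinarith
  · have := mul_le_mul_of_nonneg_left hpos (show (0 : ℤ) ≤ L by positivity)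
    nlinarith

end CrossIndep

/-- Registered stub `stub_crossIndep` of crux stmt-CriticalPhenomena-7204 (line vacant-coins-fresh-spine); see the line
skeleton `Cruxes/JumpFireBreak/Lines/vacant-coins-fresh-spine.lean` for the informal statement and sources. -/
theorem stub_crossIndep :
    ∀ (L r : ℕ), 3 ≤ L → r ≤ L → ∀ (q : ℝ) (c : Fin 3 → ℤ) (δ : ℝ), 0 ≤ δ → δ ≤ 1 →
    (∀ c' : Fin 3 → ℤ, (labelMeasure (Fin 3 → ℤ)).real
        {U | ∃ a b : Fin 3 → ℤ, a - c' ∈ (box 3 L : Set (Fin 3 → ℤ)) ∧ (∃ i, |b i - c' i| = 3 * L) ∧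
          configOfLabels q U (zdGraph 3) ∈
            openConnIn {v | v - c' ∈ (box 3 (3 * L) : Set (Fin 3 → ℤ)) ∧
              openCluster (configOfLabels (criticalProb (zdGraph 3) (0 : Fin 3 → ℤ)) U (zdGraph 3)) v ⊆
                {y | y - v ∈ (box 3 r : Set (Fin 3 → ℤ))}} a b} ≤ δ ^ ((8 + 1) ^ 3)) →
    ∀ T : Finset (Fin 3 → ℤ), (∀ x ∈ T, ∀ y ∈ T, x ≠ y → 8 < supDist x y) →
      (labelMeasure (Fin 3 → ℤ)).real (⋂ b ∈ T,
        {U | ∃ a b' : Fin 3 → ℤ, a - (c + (L : ℤ) • b) ∈ (box 3 L : Set (Fin 3 → ℤ)) ∧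
          (∃ i, |b' i - (c + (L : ℤ) • b) i| = 3 * L) ∧
          configOfLabels q U (zdGraph 3) ∈
            openConnIn {v | v - (c + (L : ℤ) • b) ∈ (box 3 (3 * L) : Set (Fin 3 → ℤ)) ∧
              openCluster (configOfLabels (criticalProb (zdGraph 3) (0 : Fin 3 → ℤ)) U (zdGraph 3)) v ⊆
                {y | y - v ∈ (box 3 r : Set (Fin 3 → ℤ))}} a b'}) ≤ δ ^ ((8 + 1) ^ 3 * T.card) := by
  intro L r hL hr q c δ _ _ hone T hT
  rw [pow_mul]
  exact CrossIndep.measureReal_biInter_le_pow T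
    (fun b => {e : Sym2 (Fin 3 → ℤ) | ∀ z ∈ e, z - (c + (L : ℤ) • b) ∈ box 3 (3 * L + r + 1)})
    (fun b _ b' _ hne => CrossIndep.disjoint_pairs_of_lt_supDist hL hr (hT b ‹_› b' ‹_› hne)) _
    (fun b _ => CrossIndep.measurableSet_iSup_crossEvt (criticalProb (zdGraph 3) (0 : Fin 3 → ℤ)) q L r _)
    fun b _ => hone (c + (L : ℤ) • b)

end Summit.CriticalPhenomena.PercolationContinuityZ3.Theorems

end
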